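import Mathlib.Analysis.Calculus.MeanValue
import Mathlib.Analysis.Calculus.ContDiff.Basic
import Mathlib.Analysis.InnerProductSpace.PiL2
import Mathlib.Analysis.SpecialFunctions.Pow.NNReal
import Mathlib.MeasureTheory.Measure.Lebesgue.EqHaar
import Mathlib.MeasureTheory.Integral.Lebesgue.Basic
import Mathlib.MeasureTheory.Measure.Haar.InnerProductSpace
import HarnessLib

/-!
# Brezis' criterion for constancy — the smooth case of Proposition 2 (dimension three)

H. Brezis, *How to recognize constant functions. Connections with Sobolev spaces*, Russian Math.
Surveys 57:4 (2002) 693–708, **Proposition 2** (p.695): if `Ω ⊂ ℝᴺ` is a connected open set and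
`f : Ω → ℝ` is measurable with `∫_Ω∫_Ω |f(x) − f(y)|^p / |x − y|^{N+p} dx dy < ∞` for some `1 ≤ p < ∞`,
then `f` is constant. [cite: Brezis2002, Prop. 2 p.695]

This file proves the SMOOTH special case in dimension `N = 3`, in contrapositive form and for every
exponent `p > 0`: if `f` is `C¹` on `ℝ³` with values in a normed space and `Df(x₀) ≠ 0` at a point
`x₀` of an open set `Ω`, then the double integral over `Ω × Ω` with exponent `3 + p` is infinite
(`lintegral_gagliardo_eq_top`); hence finiteness forces `Df = 0` on `Ω`
(`fderiv_eq_zero_of_lintegral_gagliardo_lt_top`); the section `GeneralDimension` repeats the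
argument in `ℝᴺ = EuclideanSpace ℝ ι` with exponent `N + p` (`lintegral_gagliardoN_eq_top`,
`fderiv_eq_zero_of_lintegral_gagliardoN_lt_top`). The proof is the elementary one: near `x₀`,
`‖f(x+h) − f(x)‖ ≥ (m/2)·2^{-k}` for `h` in the ball `B(2^{-k}w, 2^{-k}η)` around a direction `w` with
`‖Df(x₀)w‖ = m`, so each of these disjoint balls contributes the same positive amount to the inner
integral. TODO(general form): measurable `f` [cite: Brezis2002, Prop. 2].
Motivation: the «turbulence space» `T¹₄(Ω)` of a 2025 regularity claim (Literature.Claims.NS.Chebiam2025,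
Definition 4 (9): exponent `3 + sp` with `s = 1`, `p = 4`) contains no smooth non-constant field.
-/

open MeasureTheory Metric Set
open scoped ENNReal Topology

namespace Literature.Analysis.FunctionSpaces.BrezisConstantFunctions

noncomputable section

/-- Euclidean `ℝ³`. [folklore] -/
abbrev E3 : Type := EuclideanSpace ℝ (Fin 3)

variable {F : Type*} [NormedAddCommGroup F] [NormedSpace ℝ F]

/-- The Gagliardo-type integrand of Brezis' Proposition 2 in dimension three:
`‖f x − f y‖^p / ‖x − y‖^{3+p}` (extended non-negative reals). [cite: Brezis2002, Prop. 2 (4) p.695] -/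
def gKernel (p : ℝ) (f : E3 → F) (x y : E3) : ℝ≥0∞ :=
  ‖f x - f y‖ₑ ^ p / ‖x - y‖ₑ ^ (3 + p)

/-! ### Pointwise lower bound of the integrand -/

omit [NormedSpace ℝ F] in
/-- If `‖f x − f y‖ ≥ a₀ > 0` and `0 < ‖x − y‖ ≤ b₀` then the integrand is at least
`a₀^p / b₀^{3+p}`. [folklore] -/
private theorem gKernel_ge {p : ℝ} (hp : 0 < p) {f : E3 → F} {x y : E3} {a₀ b₀ : ℝ} (ha₀ : 0 < a₀)
    (ha : a₀ ≤ ‖f x - f y‖) (hb : ‖x - y‖ ≤ b₀) (hxy : x ≠ y) :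
    ENNReal.ofReal (a₀ ^ p / b₀ ^ (3 + p)) ≤ gKernel p f x y := by
  have hb₀ : 0 < b₀ := lt_of_lt_of_le (norm_pos_iff.mpr (sub_ne_zero.mpr hxy)) hb
  have h3p : 0 ≤ 3 + p := by linarith
  unfold gKernel
  rw [ENNReal.ofReal_div_of_pos (Real.rpow_pos_of_pos hb₀ _), ← ofReal_norm,
    ← ofReal_norm, ENNReal.ofReal_rpow_of_nonneg (norm_nonneg _) hp.le,
    ENNReal.ofReal_rpow_of_nonneg (norm_nonneg _) h3p]
  refine ENNReal.div_le_div ?_ ?_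
  · exact ENNReal.ofReal_le_ofReal (Real.rpow_le_rpow ha₀.le ha hp.le)
  · exact ENNReal.ofReal_le_ofReal (Real.rpow_le_rpow (norm_nonneg _) hb h3p)

/-! ### The analytic lower bound near a point of non-vanishing derivative -/

/-- Mean-value lower bound: if `‖Df − L‖ ≤ ε` on a convex set containing `x, y`, then
`‖L(y − x)‖ − ε‖y − x‖ ≤ ‖f x − f y‖`. [folklore] -/
private theorem norm_sub_ge_of_fderiv_near {f : E3 → F} {L : E3 →L[ℝ] F} {s : Set E3} (hs : Convex ℝ s)
    (hd : ∀ z ∈ s, DifferentiableAt ℝ f z) {ε : ℝ} (hε : ∀ z ∈ s, ‖fderiv ℝ f z - L‖ ≤ ε) {x y : E3}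
    (hx : x ∈ s) (hy : y ∈ s) : ‖L (y - x)‖ - ε * ‖y - x‖ ≤ ‖f x - f y‖ := by
  have hmv : ‖f y - f x - L (y - x)‖ ≤ ε * ‖y - x‖ :=
    hs.norm_image_sub_le_of_norm_fderiv_le' hd hε hx hy
  have htri : ‖L (y - x)‖ ≤ ‖f y - f x‖ + ‖f y - f x - L (y - x)‖ := by
    have := norm_sub_le (f y - f x) (f y - f x - L (y - x))
    simpa using this
  rw [norm_sub_rev (f x)]
  linarith

/-! ### Geometry of the pieces `B(x + c·w, c·η)` -/

/-- For `y ∈ B(x + c•w, cη)` with `η ≤ ‖w‖/4`, `c > 0`: `c·(3/4)‖w‖ ≤ ‖y − x‖ ≤ c·(5/4)‖w‖`. [folklore] -/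
private theorem norm_sub_bounds {x y w : E3} {c η : ℝ} (hc : 0 < c) (hη : η ≤ ‖w‖ / 4)
    (hy : y ∈ ball (x + c • w) (c * η)) :
    c * (3 / 4 * ‖w‖) ≤ ‖y - x‖ ∧ ‖y - x‖ ≤ c * (5 / 4 * ‖w‖) := by
  rw [mem_ball, dist_eq_norm] at hy
  have hcw : ‖c • w‖ = c * ‖w‖ := by rw [norm_smul, Real.norm_of_nonneg hc.le]
  have h1 : ‖y - x‖ ≤ ‖c • w‖ + ‖y - (x + c • w)‖ := by
    have := norm_add_le (c • w) (y - (x + c • w)); simpa [sub_add_eq_sub_sub, add_sub_cancel] using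
      (show ‖y - x‖ ≤ ‖c • w‖ + ‖y - (x + c • w)‖ by
        calc ‖y - x‖ = ‖c • w + (y - (x + c • w))‖ := by congr 1; abel
          _ ≤ ‖c • w‖ + ‖y - (x + c • w)‖ := norm_add_le _ _)
  have h2 : ‖c • w‖ ≤ ‖y - x‖ + ‖y - (x + c • w)‖ := by
    calc ‖c • w‖ = ‖(y - x) - (y - (x + c • w))‖ := by congr 1; abel
      _ ≤ ‖y - x‖ + ‖y - (x + c • w)‖ := norm_sub_le _ _
  have hcη : c * η ≤ c * (‖w‖ / 4) := mul_le_mul_of_nonneg_left hη hc.le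
  constructor <;> nlinarith [h1, h2, hy, hcη, hcw]

/-- The pieces at dyadic scales `c_j = 2^{-j}`, `c_k = 2^{-k}`, `j < k`, are disjoint. [folklore] -/
private theorem pieces_disjoint {x w : E3} {η : ℝ} (hw : 0 < ‖w‖) (hη : η ≤ ‖w‖ / 4) {j k : ℕ} (hjk : j < k) :
    Disjoint (ball (x + ((1 / 2 : ℝ) ^ j) • w) ((1 / 2 : ℝ) ^ j * η))
      (ball (x + ((1 / 2 : ℝ) ^ k) • w) ((1 / 2 : ℝ) ^ k * η)) := by
  rw [Set.disjoint_left]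
  intro y hyj hyk
  have hcj : (0 : ℝ) < (1 / 2) ^ j := by positivity
  have hck : (0 : ℝ) < (1 / 2) ^ k := by positivity
  have h1 := (norm_sub_bounds hcj hη hyj).1
  have h2 := (norm_sub_bounds hck hη hyk).2
  have hle : ((1 / 2 : ℝ) ^ k) ≤ (1 / 2) ^ (j + 1) :=
    pow_le_pow_of_le_one (by norm_num) (by norm_num) hjk
  have : ((1 / 2 : ℝ) ^ (j + 1)) = (1 / 2) ^ j * (1 / 2) := pow_succ _ _
  nlinarith [h1, h2, hle, this, hw, hcj]

/-! ### The constant contributed by each piece -/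

/-- The real number `(c m/2)^p / (c R)^{3+p} · (c η)^3` does not depend on `c > 0`. [folklore] -/
private theorem piece_const_eq {c m R η p : ℝ} (hc : 0 < c) (hm : 0 < m) (hR : 0 < R) :
    (c * (m / 2)) ^ p / (c * R) ^ (3 + p) * (c * η) ^ 3 = (m / 2) ^ p / R ^ (3 + p) * η ^ 3 := by
  have e3 : (c * R) ^ (3 : ℝ) = (c * R) ^ (3 : ℕ) := by exact_mod_cast Real.rpow_natCast (c * R) 3
  have e3' : R ^ (3 : ℝ) = R ^ (3 : ℕ) := by exact_mod_cast Real.rpow_natCast R 3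
  have h1 : (c * (m / 2)) ^ p = c ^ p * (m / 2) ^ p := Real.mul_rpow hc.le (by positivity)
  have h2 : (c * R) ^ (3 + p) = (c ^ 3 * R ^ 3) * (c ^ p * R ^ p) := by
    rw [Real.rpow_add (by positivity), e3, mul_pow, Real.mul_rpow hc.le hR.le]
  have h3 : R ^ (3 + p) = R ^ 3 * R ^ p := by rw [Real.rpow_add hR, e3']
  rw [h1, h2, h3, mul_pow]
  have hcp : 0 < c ^ p := Real.rpow_pos_of_pos hc p
  have hRp : 0 < R ^ p := Real.rpow_pos_of_pos hR p
  field_simp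

/-! ### The main theorem -/
set_option maxHeartbeats 400000 in -- buildfix (bf3-g25): 160k/180k FAIL, 200k PASS at accept time; line-neutral budget line
/-- **Brezis' Proposition 2, smooth case, contrapositive (N = 3):** if `f ∈ C¹(ℝ³; F)` and `Df(x₀) ≠ 0`
at a point `x₀` of an open set `Ω`, then for every `p > 0`
`∫_Ω∫_Ω ‖f x − f y‖^p / ‖x − y‖^{3+p} dy dx = ∞`. [cite: Brezis2002, Prop. 2 p.695] -/
theorem lintegral_gagliardo_eq_top {Ω : Set E3} (hΩ : IsOpen Ω) {f : E3 → F} (hf : ContDiff ℝ 1 f)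
    {x₀ : E3} (hx₀ : x₀ ∈ Ω) (hD : fderiv ℝ f x₀ ≠ 0) {p : ℝ} (hp : 0 < p) :
    ∫⁻ x in Ω, ∫⁻ y in Ω, gKernel p f x y = ⊤ := by
  -- a direction of non-vanishing derivative
  set L : E3 →L[ℝ] F := fderiv ℝ f x₀ with hL
  obtain ⟨w₁, hw₁⟩ : ∃ w₁, L w₁ ≠ 0 := by
    by_contra h; push Not at h; exact hD (ContinuousLinearMap.ext fun v => by simpa using h v)
  have hw₁0 : w₁ ≠ 0 := by rintro rfl; exact hw₁ (map_zero L)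
  have hw₁n : 0 < ‖w₁‖ := norm_pos_iff.mpr hw₁0
  set ρ : ℝ := ‖L w₁‖ / ‖w₁‖ with hρ
  have hρ0 : 0 < ρ := div_pos (norm_pos_iff.mpr hw₁) hw₁n
  -- continuity of the derivative and openness of Ω give a radius R
  have hcont : ContinuousAt (fderiv ℝ f) x₀ := (hf.continuous_fderiv (by norm_num)).continuousAt
  obtain ⟨δ, hδ0, hδ⟩ := Metric.continuousAt_iff.mp hcont (ρ / 5) (by positivity)
  obtain ⟨r₀, hr₀0, hr₀⟩ := Metric.isOpen_iff.mp hΩ x₀ hx₀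
  set R : ℝ := min δ r₀ / 2 with hRdef
  have hR0 : 0 < R := by rw [hRdef]; positivity
  have h2Rδ : 2 * R ≤ δ := by rw [hRdef]; linarith [min_le_left δ r₀]
  have h2Rr : 2 * R ≤ r₀ := by rw [hRdef]; linarith [min_le_right δ r₀]
  have hball : ball x₀ (2 * R) ⊆ Ω := (ball_subset_ball h2Rr).trans hr₀
  have hder : ∀ z ∈ ball x₀ (2 * R), ‖fderiv ℝ f z - L‖ ≤ ρ / 5 := fun z hz =>
    (le_of_lt (by simpa [dist_eq_norm] using hδ (lt_of_lt_of_le (mem_ball.mp hz) h2Rδ)))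
  have hdiff : ∀ z ∈ ball x₀ (2 * R), DifferentiableAt ℝ f z := fun z _ =>
    (hf.differentiable (by norm_num)).differentiableAt
  -- the rescaled direction w with ‖w‖ = 4R/5
  set t : ℝ := (4 * R / 5) / ‖w₁‖ with ht
  have ht0 : 0 < t := by rw [ht]; positivity
  set w : E3 := t • w₁ with hw
  have hwn : ‖w‖ = 4 * R / 5 := by
    rw [hw, norm_smul, Real.norm_of_nonneg ht0.le, ht]; field_simp
  have hwpos : 0 < ‖w‖ := by rw [hwn]; positivity
  set m : ℝ := ‖L w‖ with hm
  have hmρ : m = ρ * ‖w‖ := by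
    rw [hm, hw, map_smul, norm_smul, norm_smul, Real.norm_of_nonneg ht0.le, hρ]
    field_simp
  have hm0 : 0 < m := by rw [hmρ]; positivity
  -- η
  set η : ℝ := min (‖w‖ / 4) (m / (4 * (‖L‖ + 1))) with hηdef
  have hη0 : 0 < η := by rw [hηdef]; positivity
  have hηw : η ≤ ‖w‖ / 4 := min_le_left _ _
  have hηL : ‖L‖ * η ≤ m / 4 := by
    have h1 : η ≤ m / (4 * (‖L‖ + 1)) := min_le_right _ _
    have h2 : ‖L‖ * η ≤ ‖L‖ * (m / (4 * (‖L‖ + 1))) := mul_le_mul_of_nonneg_left h1 (norm_nonneg _)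
    have h3 : ‖L‖ * (m / (4 * (‖L‖ + 1))) ≤ m / 4 := by
      rw [mul_div_assoc']
      apply div_le_of_le_mul₀ (by positivity) (by positivity)
      nlinarith [norm_nonneg L, hm0]
    linarith
  -- the pieces
  let c : ℕ → ℝ := fun k => (1 / 2 : ℝ) ^ k
  have hc0 : ∀ k, 0 < c k := fun k => by positivity
  have hc1 : ∀ k, c k ≤ 1 := fun k => pow_le_one₀ (by norm_num) (by norm_num)
  let piece : E3 → ℕ → Set E3 := fun x k => ball (x + c k • w) (c k * η)
  -- the positive constant contributed by every piece
  set κ : ℝ≥0∞ := ENNReal.ofReal ((m / 2) ^ p / R ^ (3 + p) * η ^ 3) * volume (ball (0 : E3) 1)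
    with hκ
  have hκ0 : κ ≠ 0 := by
    rw [hκ]
    refine mul_ne_zero ?_ (Metric.measure_ball_pos volume (0 : E3) one_pos).ne'
    rw [ENNReal.ofReal_ne_zero_iff]  -- hmm: ofReal x ≠ 0 ↔ 0 < x
    positivity
  -- lower bound on each piece, for x ∈ ball x₀ R
  have hpiece : ∀ x ∈ ball x₀ R, ∀ k, κ ≤ ∫⁻ y in piece x k, gKernel p f x y := by
    intro x hx k
    have hxs : x ∈ ball x₀ (2 * R) := ball_subset_ball (by linarith) hx
    -- constant lower bound of the integrand on the piece
    have hconst : ∀ y ∈ piece x k,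
        ENNReal.ofReal ((c k * (m / 2)) ^ p / (c k * R) ^ (3 + p)) ≤ gKernel p f x y := by
      intro y hy
      obtain ⟨hlow, hup⟩ := norm_sub_bounds (hc0 k) hηw hy
      have hup' : ‖y - x‖ ≤ c k * R := by
        calc ‖y - x‖ ≤ c k * (5 / 4 * ‖w‖) := hup
          _ = c k * R := by rw [hwn]; ring
      have hyx : x ≠ y := by
        intro hxy; rw [hxy, sub_self, norm_zero] at hlow
        nlinarith [hc0 k, hwpos]
      have hys : y ∈ ball x₀ (2 * R) := by
        rw [mem_ball, dist_eq_norm]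
        calc ‖y - x₀‖ = ‖(y - x) + (x - x₀)‖ := by congr 1; abel
          _ ≤ ‖y - x‖ + ‖x - x₀‖ := norm_add_le _ _
          _ < c k * R + R := by
              have := mem_ball.mp hx; rw [dist_eq_norm] at this; linarith
          _ ≤ 1 * R + R := by nlinarith [hc1 k, hR0]
          _ = 2 * R := by ring
      -- ‖L (y - x)‖ ≥ c k * (3m/4)
      have hLyx : c k * (3 * m / 4) ≤ ‖L (y - x)‖ := by
        have hsplit : L (y - x) = L (c k • w) + L ((y - x) - c k • w) := by
          rw [← map_add]; congr 1; abel
        have h1 : ‖L (c k • w)‖ = c k * m := by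
          rw [map_smul, norm_smul, Real.norm_of_nonneg (hc0 k).le, hm]
        have h2 : ‖L ((y - x) - c k • w)‖ ≤ ‖L‖ * (c k * η) := by
          refine (L.le_opNorm _).trans (mul_le_mul_of_nonneg_left ?_ (norm_nonneg _))
          have : y - x - c k • w = y - (x + c k • w) := by abel
          rw [this, ← dist_eq_norm]; exact (mem_ball.mp hy).le
        have h3 : ‖L (c k • w)‖ ≤ ‖L (y - x)‖ + ‖L ((y - x) - c k • w)‖ := by
          rw [hsplit]
          calc ‖L (c k • w)‖ = ‖(L (c k • w) + L (y - x - c k • w)) - L (y - x - c k • w)‖ := by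
                  congr 1; abel
            _ ≤ ‖L (c k • w) + L (y - x - c k • w)‖ + ‖L (y - x - c k • w)‖ := norm_sub_le _ _
        have h4 : ‖L‖ * (c k * η) = c k * (‖L‖ * η) := by ring
        nlinarith [h1, h2, h3, h4, hηL, hc0 k]
      have hfxy : c k * (m / 2) ≤ ‖f x - f y‖ := by
        have hmv := norm_sub_ge_of_fderiv_near (convex_ball x₀ (2 * R)) hdiff hder hxs hys
        have hε : ρ / 5 * ‖y - x‖ ≤ c k * (m / 4) := by
          calc ρ / 5 * ‖y - x‖ ≤ ρ / 5 * (c k * R) := mul_le_mul_of_nonneg_left hup' (by positivity)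
            _ = c k * (m / 4) := by rw [hmρ, hwn]; ring
        linarith
      exact gKernel_ge hp (by positivity) hfxy (by rwa [norm_sub_rev]) hyx
    -- integrate the constant over the piece
    have hmeas : MeasurableSet (piece x k) := measurableSet_ball
    calc κ = ENNReal.ofReal ((c k * (m / 2)) ^ p / (c k * R) ^ (3 + p)) * volume (piece x k) := by
            rw [hκ, show piece x k = ball (x + c k • w) (c k * η) from rfl,
              Measure.addHaar_ball volume _ (by positivity : 0 ≤ c k * η), finrank_euclideanSpace_fin,
              ← mul_assoc, ← ENNReal.ofReal_mul (by positivity), piece_const_eq (hc0 k) hm0 hR0]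
      _ = ∫⁻ _ in piece x k, ENNReal.ofReal ((c k * (m / 2)) ^ p / (c k * R) ^ (3 + p)) := by
            rw [setLIntegral_const]
      _ ≤ ∫⁻ y in piece x k, gKernel p f x y := setLIntegral_mono' hmeas hconst
  -- the inner integral is infinite for x ∈ ball x₀ R
  have hinner : ∀ x ∈ ball x₀ R, ∫⁻ y in Ω, gKernel p f x y = ⊤ := by
    intro x hx
    have hsub : (⋃ k, piece x k) ⊆ Ω := by
      refine iUnion_subset fun k => ?_
      intro y hy
      obtain ⟨-, hup⟩ := norm_sub_bounds (hc0 k) hηw hy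
      apply hball
      rw [mem_ball, dist_eq_norm]
      have hxR : ‖x - x₀‖ < R := by have := mem_ball.mp hx; rwa [dist_eq_norm] at this
      calc ‖y - x₀‖ = ‖(y - x) + (x - x₀)‖ := by congr 1; abel
        _ ≤ ‖y - x‖ + ‖x - x₀‖ := norm_add_le _ _
        _ < c k * (5 / 4 * ‖w‖) + R := by linarith
        _ ≤ 1 * (5 / 4 * ‖w‖) + R := by nlinarith [hc1 k, hwpos]
        _ = 2 * R := by rw [hwn]; ring
    have hdisj : Pairwise (Function.onFun Disjoint (piece x)) := by
      intro j k hjk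
      rcases lt_or_gt_of_ne hjk with h | h
      · exact pieces_disjoint hwpos hηw h
      · exact (pieces_disjoint hwpos hηw h).symm
    have h1 : ∫⁻ y in ⋃ k, piece x k, gKernel p f x y ≤ ∫⁻ y in Ω, gKernel p f x y :=
      lintegral_mono_set hsub
    have h2 : ∫⁻ y in ⋃ k, piece x k, gKernel p f x y = ∑' k, ∫⁻ y in piece x k, gKernel p f x y :=
      lintegral_iUnion (fun k => measurableSet_ball) hdisj _
    have h3 : (∑' _ : ℕ, κ) ≤ ∑' k, ∫⁻ y in piece x k, gKernel p f x y :=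
      ENNReal.tsum_le_tsum fun k => hpiece x hx k
    rw [ENNReal.tsum_const_eq_top_of_ne_zero hκ0] at h3
    exact eq_top_iff.mpr (h3.trans (h2 ▸ h1))
  -- integrate over x
  have h4 : ∫⁻ x in ball x₀ R, ∫⁻ y in Ω, gKernel p f x y ≤ ∫⁻ x in Ω, ∫⁻ y in Ω, gKernel p f x y :=
    lintegral_mono_set ((ball_subset_ball (by linarith)).trans hball)
  have h5 : ∫⁻ x in ball x₀ R, ∫⁻ y in Ω, gKernel p f x y = ∫⁻ _ in ball x₀ R, (⊤ : ℝ≥0∞) :=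
    setLIntegral_congr_fun measurableSet_ball hinner
  rw [h5, setLIntegral_const, ENNReal.top_mul (Metric.measure_ball_pos volume x₀ hR0).ne'] at h4
  exact eq_top_iff.mpr h4

/-- **Corollary (smooth Brezis, N = 3):** a `C¹` function whose Gagliardo double integral with exponent
`3 + p` over an open set `Ω` is finite has vanishing derivative on `Ω` (hence is locally constant
there). [cite: Brezis2002, Prop. 2 p.695] -/
theorem fderiv_eq_zero_of_lintegral_gagliardo_lt_top {Ω : Set E3} (hΩ : IsOpen Ω) {f : E3 → F}
    (hf : ContDiff ℝ 1 f) {p : ℝ} (hp : 0 < p)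
    (hfin : ∫⁻ x in Ω, ∫⁻ y in Ω, gKernel p f x y < ⊤) : ∀ x ∈ Ω, fderiv ℝ f x = 0 := by
  intro x hx
  by_contra hD
  exact hfin.ne (lintegral_gagliardo_eq_top hΩ hf hx hD hp)

/-! ## General dimension `N = |ι|` (`EuclideanSpace ℝ ι`), exponent `N + p`

The same argument in `ℝᴺ`; the `N = 3` statements above are kept for their users. -/

section GeneralDimension

variable {ι : Type*} [Fintype ι]

/-- Euclidean `ℝᴺ` with `N = |ι|`. [folklore] -/
abbrev EN (ι : Type*) : Type _ := EuclideanSpace ℝ ι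

/-- The Gagliardo-type integrand of Brezis' Proposition 2 in dimension `N = |ι|`:
`‖f x − f y‖^p / ‖x − y‖^{N+p}` (extended non-negative reals). [cite: Brezis2002, Prop. 2 (4) p.695] -/
def gKernelN (p : ℝ) (f : EN ι → F) (x y : EN ι) : ℝ≥0∞ :=
  ‖f x - f y‖ₑ ^ p / ‖x - y‖ₑ ^ ((Fintype.card ι : ℝ) + p)

/-! ### Pointwise lower bound of the integrand -/

omit [NormedSpace ℝ F] in
/-- If `‖f x − f y‖ ≥ a₀ > 0` and `0 < ‖x − y‖ ≤ b₀` then the integrand is at least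
`a₀^p / b₀^{N+p}`. [folklore] -/
private theorem gKernelN_ge {p : ℝ} (hp : 0 < p) {f : EN ι → F} {x y : EN ι} {a₀ b₀ : ℝ} (ha₀ : 0 < a₀)
    (ha : a₀ ≤ ‖f x - f y‖) (hb : ‖x - y‖ ≤ b₀) (hxy : x ≠ y) :
    ENNReal.ofReal (a₀ ^ p / b₀ ^ ((Fintype.card ι : ℝ) + p)) ≤ gKernelN p f x y := by
  have hb₀ : 0 < b₀ := lt_of_lt_of_le (norm_pos_iff.mpr (sub_ne_zero.mpr hxy)) hb
  have h3p : 0 ≤ (Fintype.card ι : ℝ) + p := by positivity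
  unfold gKernelN
  rw [ENNReal.ofReal_div_of_pos (Real.rpow_pos_of_pos hb₀ _), ← ofReal_norm,
    ← ofReal_norm, ENNReal.ofReal_rpow_of_nonneg (norm_nonneg _) hp.le,
    ENNReal.ofReal_rpow_of_nonneg (norm_nonneg _) h3p]
  refine ENNReal.div_le_div ?_ ?_
  · exact ENNReal.ofReal_le_ofReal (Real.rpow_le_rpow ha₀.le ha hp.le)
  · exact ENNReal.ofReal_le_ofReal (Real.rpow_le_rpow (norm_nonneg _) hb h3p)

/-! ### The analytic lower bound near a point of non-vanishing derivative -/

/-- Mean-value lower bound: if `‖Df − L‖ ≤ ε` on a convex set containing `x, y`, then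
`‖L(y − x)‖ − ε‖y − x‖ ≤ ‖f x − f y‖`. [folklore] -/
private theorem norm_sub_ge_of_fderiv_nearN {f : EN ι → F} {L : EN ι →L[ℝ] F} {s : Set (EN ι)} (hs : Convex ℝ s)
    (hd : ∀ z ∈ s, DifferentiableAt ℝ f z) {ε : ℝ} (hε : ∀ z ∈ s, ‖fderiv ℝ f z - L‖ ≤ ε) {x y : EN ι}
    (hx : x ∈ s) (hy : y ∈ s) : ‖L (y - x)‖ - ε * ‖y - x‖ ≤ ‖f x - f y‖ := by
  have hmv : ‖f y - f x - L (y - x)‖ ≤ ε * ‖y - x‖ :=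
    hs.norm_image_sub_le_of_norm_fderiv_le' hd hε hx hy
  have htri : ‖L (y - x)‖ ≤ ‖f y - f x‖ + ‖f y - f x - L (y - x)‖ := by
    have := norm_sub_le (f y - f x) (f y - f x - L (y - x))
    simpa using this
  rw [norm_sub_rev (f x)]
  linarith

/-! ### Geometry of the pieces `B(x + c·w, c·η)` -/

/-- For `y ∈ B(x + c•w, cη)` with `η ≤ ‖w‖/4`, `c > 0`: `c·(3/4)‖w‖ ≤ ‖y − x‖ ≤ c·(5/4)‖w‖`. [folklore] -/
private theorem norm_sub_boundsN {x y w : EN ι} {c η : ℝ} (hc : 0 < c) (hη : η ≤ ‖w‖ / 4)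
    (hy : y ∈ ball (x + c • w) (c * η)) :
    c * (3 / 4 * ‖w‖) ≤ ‖y - x‖ ∧ ‖y - x‖ ≤ c * (5 / 4 * ‖w‖) := by
  rw [mem_ball, dist_eq_norm] at hy
  have hcw : ‖c • w‖ = c * ‖w‖ := by rw [norm_smul, Real.norm_of_nonneg hc.le]
  have h1 : ‖y - x‖ ≤ ‖c • w‖ + ‖y - (x + c • w)‖ := by
    have := norm_add_le (c • w) (y - (x + c • w)); simpa [sub_add_eq_sub_sub, add_sub_cancel] using
      (show ‖y - x‖ ≤ ‖c • w‖ + ‖y - (x + c • w)‖ by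
        calc ‖y - x‖ = ‖c • w + (y - (x + c • w))‖ := by congr 1; abel
          _ ≤ ‖c • w‖ + ‖y - (x + c • w)‖ := norm_add_le _ _)
  have h2 : ‖c • w‖ ≤ ‖y - x‖ + ‖y - (x + c • w)‖ := by
    calc ‖c • w‖ = ‖(y - x) - (y - (x + c • w))‖ := by congr 1; abel
      _ ≤ ‖y - x‖ + ‖y - (x + c • w)‖ := norm_sub_le _ _
  have hcη : c * η ≤ c * (‖w‖ / 4) := mul_le_mul_of_nonneg_left hη hc.le
  constructor <;> nlinarith [h1, h2, hy, hcη, hcw]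

/-- The pieces at dyadic scales `c_j = 2^{-j}`, `c_k = 2^{-k}`, `j < k`, are disjoint. [folklore] -/
private theorem pieces_disjointN {x w : EN ι} {η : ℝ} (hw : 0 < ‖w‖) (hη : η ≤ ‖w‖ / 4) {j k : ℕ} (hjk : j < k) :
    Disjoint (ball (x + ((1 / 2 : ℝ) ^ j) • w) ((1 / 2 : ℝ) ^ j * η))
      (ball (x + ((1 / 2 : ℝ) ^ k) • w) ((1 / 2 : ℝ) ^ k * η)) := by
  rw [Set.disjoint_left]
  intro y hyj hyk
  have hcj : (0 : ℝ) < (1 / 2) ^ j := by positivity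
  have hck : (0 : ℝ) < (1 / 2) ^ k := by positivity
  have h1 := (norm_sub_boundsN hcj hη hyj).1
  have h2 := (norm_sub_boundsN hck hη hyk).2
  have hle : ((1 / 2 : ℝ) ^ k) ≤ (1 / 2) ^ (j + 1) :=
    pow_le_pow_of_le_one (by norm_num) (by norm_num) hjk
  have : ((1 / 2 : ℝ) ^ (j + 1)) = (1 / 2) ^ j * (1 / 2) := pow_succ _ _
  nlinarith [h1, h2, hle, this, hw, hcj]

/-! ### The constant contributed by each piece -/

/-- The real number `(c m/2)^p / (c R)^{N+p} · (c η)^N` does not depend on `c > 0`. [folklore] -/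
private theorem piece_const_eqN {c m R η p : ℝ} (hc : 0 < c) (hm : 0 < m) (hR : 0 < R) :
    (c * (m / 2)) ^ p / (c * R) ^ ((Fintype.card ι : ℝ) + p) * (c * η) ^ (Fintype.card ι) =
      (m / 2) ^ p / R ^ ((Fintype.card ι : ℝ) + p) * η ^ (Fintype.card ι) := by
  set d : ℕ := Fintype.card ι
  have e3 : (c * R) ^ (d : ℝ) = (c * R) ^ d := Real.rpow_natCast (c * R) d
  have e3' : R ^ (d : ℝ) = R ^ d := Real.rpow_natCast R d
  have h1 : (c * (m / 2)) ^ p = c ^ p * (m / 2) ^ p := Real.mul_rpow hc.le (by positivity)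
  have h2 : (c * R) ^ ((d : ℝ) + p) = (c ^ d * R ^ d) * (c ^ p * R ^ p) := by
    rw [Real.rpow_add (by positivity), e3, mul_pow, Real.mul_rpow hc.le hR.le]
  have h3 : R ^ ((d : ℝ) + p) = R ^ d * R ^ p := by rw [Real.rpow_add hR, e3']
  rw [h1, h2, h3, mul_pow]
  have hcp : 0 < c ^ p := Real.rpow_pos_of_pos hc p
  have hRp : 0 < R ^ p := Real.rpow_pos_of_pos hR p
  have hcd : 0 < c ^ d := pow_pos hc d
  field_simp

/-! ### The main theorem -/
set_option maxHeartbeats 400000 in -- buildfix (bf3-g25): 160k/180k FAIL, 200k PASS at accept time; line-neutral budget line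
/-- **Brezis' Proposition 2, smooth case, contrapositive (general N = |ι| ≥ 1):** if
`f ∈ C¹(ℝᴺ; F)` and `Df(x₀) ≠ 0` at a point `x₀` of an open set `Ω ⊆ ℝᴺ = EuclideanSpace ℝ ι`, then
for every `p > 0`, `∫_Ω∫_Ω ‖f x − f y‖^p / ‖x − y‖^{N+p} dy dx = ∞`. [cite: Brezis2002, Prop. 2 p.695] -/
theorem lintegral_gagliardoN_eq_top [Nonempty ι] {Ω : Set (EN ι)} (hΩ : IsOpen Ω) {f : EN ι → F} (hf : ContDiff ℝ 1 f)
    {x₀ : EN ι} (hx₀ : x₀ ∈ Ω) (hD : fderiv ℝ f x₀ ≠ 0) {p : ℝ} (hp : 0 < p) :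
    ∫⁻ x in Ω, ∫⁻ y in Ω, gKernelN p f x y = ⊤ := by
  -- a direction of non-vanishing derivative
  set L : EN ι →L[ℝ] F := fderiv ℝ f x₀ with hL
  obtain ⟨w₁, hw₁⟩ : ∃ w₁, L w₁ ≠ 0 := by
    by_contra h; push Not at h; exact hD (ContinuousLinearMap.ext fun v => by simpa using h v)
  have hw₁0 : w₁ ≠ 0 := by rintro rfl; exact hw₁ (map_zero L)
  have hw₁n : 0 < ‖w₁‖ := norm_pos_iff.mpr hw₁0
  set ρ : ℝ := ‖L w₁‖ / ‖w₁‖ with hρ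
  have hρ0 : 0 < ρ := div_pos (norm_pos_iff.mpr hw₁) hw₁n
  -- continuity of the derivative and openness of Ω give a radius R
  have hcont : ContinuousAt (fderiv ℝ f) x₀ := (hf.continuous_fderiv (by norm_num)).continuousAt
  obtain ⟨δ, hδ0, hδ⟩ := Metric.continuousAt_iff.mp hcont (ρ / 5) (by positivity)
  obtain ⟨r₀, hr₀0, hr₀⟩ := Metric.isOpen_iff.mp hΩ x₀ hx₀
  set R : ℝ := min δ r₀ / 2 with hRdef
  have hR0 : 0 < R := by rw [hRdef]; positivity
  have h2Rδ : 2 * R ≤ δ := by rw [hRdef]; linarith [min_le_left δ r₀]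
  have h2Rr : 2 * R ≤ r₀ := by rw [hRdef]; linarith [min_le_right δ r₀]
  have hball : ball x₀ (2 * R) ⊆ Ω := (ball_subset_ball h2Rr).trans hr₀
  have hder : ∀ z ∈ ball x₀ (2 * R), ‖fderiv ℝ f z - L‖ ≤ ρ / 5 := fun z hz =>
    (le_of_lt (by simpa [dist_eq_norm] using hδ (lt_of_lt_of_le (mem_ball.mp hz) h2Rδ)))
  have hdiff : ∀ z ∈ ball x₀ (2 * R), DifferentiableAt ℝ f z := fun z _ =>
    (hf.differentiable (by norm_num)).differentiableAt
  -- the rescaled direction w with ‖w‖ = 4R/5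
  set t : ℝ := (4 * R / 5) / ‖w₁‖ with ht
  have ht0 : 0 < t := by rw [ht]; positivity
  set w : EN ι := t • w₁ with hw
  have hwn : ‖w‖ = 4 * R / 5 := by
    rw [hw, norm_smul, Real.norm_of_nonneg ht0.le, ht]; field_simp
  have hwpos : 0 < ‖w‖ := by rw [hwn]; positivity
  set m : ℝ := ‖L w‖ with hm
  have hmρ : m = ρ * ‖w‖ := by
    rw [hm, hw, map_smul, norm_smul, norm_smul, Real.norm_of_nonneg ht0.le, hρ]
    field_simp
  have hm0 : 0 < m := by rw [hmρ]; positivity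
  -- η
  set η : ℝ := min (‖w‖ / 4) (m / (4 * (‖L‖ + 1))) with hηdef
  have hη0 : 0 < η := by rw [hηdef]; positivity
  have hηw : η ≤ ‖w‖ / 4 := min_le_left _ _
  have hηL : ‖L‖ * η ≤ m / 4 := by
    have h1 : η ≤ m / (4 * (‖L‖ + 1)) := min_le_right _ _
    have h2 : ‖L‖ * η ≤ ‖L‖ * (m / (4 * (‖L‖ + 1))) := mul_le_mul_of_nonneg_left h1 (norm_nonneg _)
    have h3 : ‖L‖ * (m / (4 * (‖L‖ + 1))) ≤ m / 4 := by
      rw [mul_div_assoc']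
      apply div_le_of_le_mul₀ (by positivity) (by positivity)
      nlinarith [norm_nonneg L, hm0]
    linarith
  -- the pieces
  let c : ℕ → ℝ := fun k => (1 / 2 : ℝ) ^ k
  have hc0 : ∀ k, 0 < c k := fun k => by positivity
  have hc1 : ∀ k, c k ≤ 1 := fun k => pow_le_one₀ (by norm_num) (by norm_num)
  let piece : EN ι → ℕ → Set (EN ι) := fun x k => ball (x + c k • w) (c k * η)
  -- the positive constant contributed by every piece
  set κ : ℝ≥0∞ := ENNReal.ofReal ((m / 2) ^ p / R ^ ((Fintype.card ι : ℝ) + p) * η ^ (Fintype.card ι)) * volume (ball (0 : EN ι) 1)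
    with hκ
  have hκ0 : κ ≠ 0 := by
    rw [hκ]
    refine mul_ne_zero ?_ (Metric.measure_ball_pos volume (0 : EN ι) one_pos).ne'
    rw [ENNReal.ofReal_ne_zero_iff]  -- hmm: ofReal x ≠ 0 ↔ 0 < x
    positivity
  -- lower bound on each piece, for x ∈ ball x₀ R
  have hpiece : ∀ x ∈ ball x₀ R, ∀ k, κ ≤ ∫⁻ y in piece x k, gKernelN p f x y := by
    intro x hx k
    have hxs : x ∈ ball x₀ (2 * R) := ball_subset_ball (by linarith) hx
    -- constant lower bound of the integrand on the piece
    have hconst : ∀ y ∈ piece x k,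
        ENNReal.ofReal ((c k * (m / 2)) ^ p / (c k * R) ^ ((Fintype.card ι : ℝ) + p)) ≤ gKernelN p f x y := by
      intro y hy
      obtain ⟨hlow, hup⟩ := norm_sub_boundsN (hc0 k) hηw hy
      have hup' : ‖y - x‖ ≤ c k * R := by
        calc ‖y - x‖ ≤ c k * (5 / 4 * ‖w‖) := hup
          _ = c k * R := by rw [hwn]; ring
      have hyx : x ≠ y := by
        intro hxy; rw [hxy, sub_self, norm_zero] at hlow
        nlinarith [hc0 k, hwpos]
      have hys : y ∈ ball x₀ (2 * R) := by
        rw [mem_ball, dist_eq_norm]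
        calc ‖y - x₀‖ = ‖(y - x) + (x - x₀)‖ := by congr 1; abel
          _ ≤ ‖y - x‖ + ‖x - x₀‖ := norm_add_le _ _
          _ < c k * R + R := by
              have := mem_ball.mp hx; rw [dist_eq_norm] at this; linarith
          _ ≤ 1 * R + R := by nlinarith [hc1 k, hR0]
          _ = 2 * R := by ring
      -- ‖L (y - x)‖ ≥ c k * (3m/4)
      have hLyx : c k * (3 * m / 4) ≤ ‖L (y - x)‖ := by
        have hsplit : L (y - x) = L (c k • w) + L ((y - x) - c k • w) := by
          rw [← map_add]; congr 1; abel
        have h1 : ‖L (c k • w)‖ = c k * m := by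
          rw [map_smul, norm_smul, Real.norm_of_nonneg (hc0 k).le, hm]
        have h2 : ‖L ((y - x) - c k • w)‖ ≤ ‖L‖ * (c k * η) := by
          refine (L.le_opNorm _).trans (mul_le_mul_of_nonneg_left ?_ (norm_nonneg _))
          have : y - x - c k • w = y - (x + c k • w) := by abel
          rw [this, ← dist_eq_norm]; exact (mem_ball.mp hy).le
        have h3 : ‖L (c k • w)‖ ≤ ‖L (y - x)‖ + ‖L ((y - x) - c k • w)‖ := by
          rw [hsplit]
          calc ‖L (c k • w)‖ = ‖(L (c k • w) + L (y - x - c k • w)) - L (y - x - c k • w)‖ := by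
                  congr 1; abel
            _ ≤ ‖L (c k • w) + L (y - x - c k • w)‖ + ‖L (y - x - c k • w)‖ := norm_sub_le _ _
        have h4 : ‖L‖ * (c k * η) = c k * (‖L‖ * η) := by ring
        nlinarith [h1, h2, h3, h4, hηL, hc0 k]
      have hfxy : c k * (m / 2) ≤ ‖f x - f y‖ := by
        have hmv := norm_sub_ge_of_fderiv_nearN (convex_ball x₀ (2 * R)) hdiff hder hxs hys
        have hε : ρ / 5 * ‖y - x‖ ≤ c k * (m / 4) := by
          calc ρ / 5 * ‖y - x‖ ≤ ρ / 5 * (c k * R) := mul_le_mul_of_nonneg_left hup' (by positivity)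
            _ = c k * (m / 4) := by rw [hmρ, hwn]; ring
        linarith
      exact gKernelN_ge hp (by positivity) hfxy (by rwa [norm_sub_rev]) hyx
    -- integrate the constant over the piece
    have hmeas : MeasurableSet (piece x k) := measurableSet_ball
    calc κ = ENNReal.ofReal ((c k * (m / 2)) ^ p / (c k * R) ^ ((Fintype.card ι : ℝ) + p)) * volume (piece x k) := by
            rw [hκ, show piece x k = ball (x + c k • w) (c k * η) from rfl,
              Measure.addHaar_ball volume _ (by positivity : 0 ≤ c k * η), finrank_euclideanSpace,
              ← mul_assoc, ← ENNReal.ofReal_mul (by positivity), piece_const_eqN (hc0 k) hm0 hR0]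
      _ = ∫⁻ _ in piece x k, ENNReal.ofReal ((c k * (m / 2)) ^ p / (c k * R) ^ ((Fintype.card ι : ℝ) + p)) := by
            rw [setLIntegral_const]
      _ ≤ ∫⁻ y in piece x k, gKernelN p f x y := setLIntegral_mono' hmeas hconst
  -- the inner integral is infinite for x ∈ ball x₀ R
  have hinner : ∀ x ∈ ball x₀ R, ∫⁻ y in Ω, gKernelN p f x y = ⊤ := by
    intro x hx
    have hsub : (⋃ k, piece x k) ⊆ Ω := by
      refine iUnion_subset fun k => ?_
      intro y hy
      obtain ⟨-, hup⟩ := norm_sub_boundsN (hc0 k) hηw hy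
      apply hball
      rw [mem_ball, dist_eq_norm]
      have hxR : ‖x - x₀‖ < R := by have := mem_ball.mp hx; rwa [dist_eq_norm] at this
      calc ‖y - x₀‖ = ‖(y - x) + (x - x₀)‖ := by congr 1; abel
        _ ≤ ‖y - x‖ + ‖x - x₀‖ := norm_add_le _ _
        _ < c k * (5 / 4 * ‖w‖) + R := by linarith
        _ ≤ 1 * (5 / 4 * ‖w‖) + R := by nlinarith [hc1 k, hwpos]
        _ = 2 * R := by rw [hwn]; ring
    have hdisj : Pairwise (Function.onFun Disjoint (piece x)) := by
      intro j k hjk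
      rcases lt_or_gt_of_ne hjk with h | h
      · exact pieces_disjointN hwpos hηw h
      · exact (pieces_disjointN hwpos hηw h).symm
    have h1 : ∫⁻ y in ⋃ k, piece x k, gKernelN p f x y ≤ ∫⁻ y in Ω, gKernelN p f x y :=
      lintegral_mono_set hsub
    have h2 : ∫⁻ y in ⋃ k, piece x k, gKernelN p f x y = ∑' k, ∫⁻ y in piece x k, gKernelN p f x y :=
      lintegral_iUnion (fun k => measurableSet_ball) hdisj _
    have h3 : (∑' _ : ℕ, κ) ≤ ∑' k, ∫⁻ y in piece x k, gKernelN p f x y :=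
      ENNReal.tsum_le_tsum fun k => hpiece x hx k
    rw [ENNReal.tsum_const_eq_top_of_ne_zero hκ0] at h3
    exact eq_top_iff.mpr (h3.trans (h2 ▸ h1))
  -- integrate over x
  have h4 : ∫⁻ x in ball x₀ R, ∫⁻ y in Ω, gKernelN p f x y ≤ ∫⁻ x in Ω, ∫⁻ y in Ω, gKernelN p f x y :=
    lintegral_mono_set ((ball_subset_ball (by linarith)).trans hball)
  have h5 : ∫⁻ x in ball x₀ R, ∫⁻ y in Ω, gKernelN p f x y = ∫⁻ _ in ball x₀ R, (⊤ : ℝ≥0∞) :=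
    setLIntegral_congr_fun measurableSet_ball hinner
  rw [h5, setLIntegral_const, ENNReal.top_mul (Metric.measure_ball_pos volume x₀ hR0).ne'] at h4
  exact eq_top_iff.mpr h4

/-- **Corollary (smooth Brezis, N = 3):** a `C¹` function whose Gagliardo double integral with exponent
`(Fintype.card ι : ℝ) + p` over an open set `Ω` is finite has vanishing derivative on `Ω` (hence is locally constant
there). [cite: Brezis2002, Prop. 2 p.695] -/
theorem fderiv_eq_zero_of_lintegral_gagliardoN_lt_top [Nonempty ι] {Ω : Set (EN ι)} (hΩ : IsOpen Ω) {f : EN ι → F}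
    (hf : ContDiff ℝ 1 f) {p : ℝ} (hp : 0 < p)
    (hfin : ∫⁻ x in Ω, ∫⁻ y in Ω, gKernelN p f x y < ⊤) : ∀ x ∈ Ω, fderiv ℝ f x = 0 := by
  intro x hx
  by_contra hD
  exact hfin.ne (lintegral_gagliardoN_eq_top hΩ hf hx hD hp)

end GeneralDimension

end

end Literature.Analysis.FunctionSpaces.BrezisConstantFunctions
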